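import Mathlib

/-!
# Critic certificate (stub-critic g37) for card k1-g35 «ONE INERTIA COSET» — the load-bearing algebra,
kernel-checked independently of the ideator's (unpublished at grading time) sketch `CosetCutK1G35`.

Abstract model: the convolution algebra of measures on `𝒢′` is a commutative `𝕜`-algebra `A`; the finite
inertia group `I` sits inside through group-likes `δ : I →* A` (Diracs); integration against a multiplicative
tower-continuous `ρ` is an ALGEBRA HOM `Φ : A →ₐ[𝕜] 𝕜` (tree `GroupDistribution.integral_conv_of_mul`) of
inertia TYPE `Φ ∘ δ`; a separating family of test characters is a set `𝔛` of algebra homs detecting equality.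
`E_θ := Σ_h θ(h⁻¹) • δ h` is the integral coset element.  Nothing here is BSD, the crux or the stub.
-/

set_option linter.dupNamespace false

namespace Summit.BirchSwinnertonDyer.BirchSwinnertonDyer.Cruxes.SplitBadTwoLowerHalfOfFacts.CriticCosetCutG37

open Finset

variable {I : Type*} [CommGroup I] [Fintype I]
variable {𝕜 : Type*} [Field 𝕜]
variable {A : Type*} [CommRing A] [Algebra 𝕜 A]

/-- The integral coset element `E_θ = Σ_{h ∈ I} θ(h⁻¹) • δ_h`. -/
noncomputable def cosetSum (δ : I →* A) (θ : I →* 𝕜) : A := ∑ h : I, θ h⁻¹ • δ h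

/-- The inertia sum `Σ_h δ_h = E_1`. -/
noncomputable def inertiaSum (δ : I →* A) : A := ∑ h : I, δ h

variable (𝕜) in
theorem inertiaSum_eq_cosetSum_one (δ : I →* A) :
    inertiaSum δ = cosetSum δ (1 : I →* 𝕜) := by
  simp [inertiaSum, cosetSum]

/-- The twisted type `h ↦ θ(h⁻¹) · Φ(δ h)` of an evaluation `Φ` against `θ`, as a monoid hom `I →* 𝕜`. -/
noncomputable def twist (δ : I →* A) (θ : I →* 𝕜) (Φ : A →ₐ[𝕜] 𝕜) : I →* 𝕜 where
  toFun h := θ h⁻¹ * Φ (δ h)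
  map_one' := by simp
  map_mul' a b := by
    simp only [mul_inv, map_mul]
    ring

omit [Fintype I] in
theorem theta_ne_zero (θ : I →* 𝕜) (h : I) : θ h ≠ 0 := by
  intro h0
  have : θ h * θ h⁻¹ = 1 := by rw [← map_mul, mul_inv_cancel, map_one]
  rw [h0, zero_mul] at this
  exact zero_ne_one this

omit [Fintype I] in
theorem twist_eq_one_iff (δ : I →* A) (θ : I →* 𝕜) (Φ : A →ₐ[𝕜] 𝕜) :
    twist δ θ Φ = 1 ↔ ∀ h, Φ (δ h) = θ h := by
  constructor
  · intro h1 h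
    have := DFunLike.congr_fun h1 h
    simp only [twist, MonoidHom.coe_mk, OneHom.coe_mk, MonoidHom.one_apply] at this
    have hθ : θ h⁻¹ * θ h = 1 := by rw [← map_mul, inv_mul_cancel, map_one]
    have hne := theta_ne_zero θ h⁻¹
    -- θ h⁻¹ * Φ (δ h) = 1 = θ h⁻¹ * θ h
    have : θ h⁻¹ * Φ (δ h) = θ h⁻¹ * θ h := by rw [this, hθ]
    exact mul_left_cancel₀ hne this
  · intro hΦ
    ext h
    simp only [twist, MonoidHom.coe_mk, OneHom.coe_mk, MonoidHom.one_apply, hΦ]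
    rw [← map_mul, inv_mul_cancel, map_one]

/-- ORTHOGONALITY: `Φ(E_θ) = |I|` if `Φ` has type `θ`, else `0`. -/
theorem eval_cosetSum (δ : I →* A) (θ : I →* 𝕜) (Φ : A →ₐ[𝕜] 𝕜) [Decidable (∀ h, Φ (δ h) = θ h)] :
    Φ (cosetSum δ θ) = if (∀ h, Φ (δ h) = θ h) then (Fintype.card I : 𝕜) else 0 := by
  have hsum : Φ (cosetSum δ θ) = ∑ h : I, twist δ θ Φ h := by
    simp [cosetSum, map_sum, twist]
  rw [hsum]
  split_ifs with hΦ
  · have h1 : twist δ θ Φ = 1 := (twist_eq_one_iff δ θ Φ).2 hΦ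
    simp [h1]
  · have h1 : twist δ θ Φ ≠ 1 := fun h => hΦ ((twist_eq_one_iff δ θ Φ).1 h)
    exact sum_hom_units_eq_zero (twist δ θ Φ) h1

theorem eval_cosetSum_of_type (δ : I →* A) (θ : I →* 𝕜) (Φ : A →ₐ[𝕜] 𝕜)
    (hΦ : ∀ h, Φ (δ h) = θ h) : Φ (cosetSum δ θ) = (Fintype.card I : 𝕜) := by
  classical
  rw [eval_cosetSum, if_pos hΦ]

theorem eval_cosetSum_of_ne (δ : I →* A) (θ : I →* 𝕜) (Φ : A →ₐ[𝕜] 𝕜)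
    (hΦ : ¬ ∀ h, Φ (δ h) = θ h) : Φ (cosetSum δ θ) = 0 := by
  classical
  rw [eval_cosetSum, if_neg hΦ]

/-- A family of evaluations SEPARATES `A` (H-FI: characters separate bounded measures). -/
def Separates (𝔛 : Set (A →ₐ[𝕜] 𝕜)) : Prop := ∀ x y : A, (∀ Φ ∈ 𝔛, Φ x = Φ y) → x = y

/-- The type-`θ` COSET of a table: equality of `Φ`-values at the type-`θ` members of `𝔛` only. -/
def CosetTables (δ : I →* A) (𝔛 : Set (A →ₐ[𝕜] 𝕜)) (θ : I →* 𝕜) (X Y : A) : Prop :=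
  ∀ Φ ∈ 𝔛, (∀ h, Φ (δ h) = θ h) → Φ X = Φ Y

/-- THE CUT IS LOSSLESS AND SUFFICIENT: coset tables ⟺ the `E_θ`-component identity. -/
theorem cosetTables_iff_cosetSum_mul_eq (δ : I →* A) (𝔛 : Set (A →ₐ[𝕜] 𝕜)) (hsep : Separates 𝔛)
    (θ : I →* 𝕜) (hI : (Fintype.card I : 𝕜) ≠ 0) (X Y : A) :
    CosetTables δ 𝔛 θ X Y ↔ cosetSum δ θ * X = cosetSum δ θ * Y := by
  constructor
  · intro htab
    apply hsep
    intro Φ hΦ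
    rw [map_mul, map_mul]
    by_cases ht : ∀ h, Φ (δ h) = θ h
    · rw [eval_cosetSum_of_type δ θ Φ ht, htab Φ hΦ ht]
    · rw [eval_cosetSum_of_ne δ θ Φ ht, zero_mul, zero_mul]
  · intro heq Φ _ ht
    have := congrArg Φ heq
    rw [map_mul, map_mul, eval_cosetSum_of_type δ θ Φ ht] at this
    exact mul_left_cancel₀ hI this

/-- VALUE CUT: the coset table decides EVERY type-`θ` evaluation, in `𝔛` or not (e.g. `ρ_v` of infinite order). -/
theorem eval_eq_of_cosetTables (δ : I →* A) (𝔛 : Set (A →ₐ[𝕜] 𝕜)) (hsep : Separates 𝔛)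
    (θ : I →* 𝕜) (hI : (Fintype.card I : 𝕜) ≠ 0) {X Y : A} (htab : CosetTables δ 𝔛 θ X Y)
    (Ψ : A →ₐ[𝕜] 𝕜) (hΨ : ∀ h, Ψ (δ h) = θ h) : Ψ X = Ψ Y := by
  have heq := (cosetTables_iff_cosetSum_mul_eq δ 𝔛 hsep θ hI X Y).1 htab
  have := congrArg Ψ heq
  rw [map_mul, map_mul, eval_cosetSum_of_type δ θ Ψ hΨ] at this
  exact mul_left_cancel₀ hI this

/-- WHAT LEAVES: an evaluation of type `≠ θ` sees nothing of the `E_θ`-component. -/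
theorem eval_cosetSum_mul_of_type_ne (δ : I →* A) (θ : I →* 𝕜) (Φ : A →ₐ[𝕜] 𝕜)
    (hΦ : ¬ ∀ h, Φ (δ h) = θ h) (Z : A) : Φ (cosetSum δ θ * Z) = 0 := by
  rw [map_mul, eval_cosetSum_of_ne δ θ Φ hΦ, zero_mul]

/-- The universal-norm / Euler-type column `1 − (Σ_h δ_h)·z` is `≡ 1` at every type `θ ≠ 1`. -/
theorem eval_one_sub_inertiaSum_mul (δ : I →* A) (θ : I →* 𝕜) (hθ : θ ≠ 1) (Φ : A →ₐ[𝕜] 𝕜)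
    (hΦ : ∀ h, Φ (δ h) = θ h) (z : A) : Φ (1 - inertiaSum δ * z) = 1 := by
  have hne : ¬ ∀ h, Φ (δ h) = (1 : I →* 𝕜) h := by
    intro h1
    apply hθ
    ext h
    rw [← hΦ h, h1 h]
  rw [map_sub, map_one, map_mul, inertiaSum_eq_cosetSum_one 𝕜 δ, eval_cosetSum_of_ne δ 1 Φ hne, zero_mul,
    sub_zero]

/-- THE NORMALISED VALUE IDENTITY at a type-`θ` evaluation (`Ψ 𝒜 = 1`): the shape R197a′ consumes. -/
theorem value_of_cosetTables_normalised (δ : I →* A) (𝔛 : Set (A →ₐ[𝕜] 𝕜)) (hsep : Separates 𝔛)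
    (θ : I →* 𝕜) (hI : (Fintype.card I : 𝕜) ≠ 0) (𝒜 katz C col : A)
    (htab : CosetTables δ 𝔛 θ (𝒜 * katz) (C * col))
    (Ψ : A →ₐ[𝕜] 𝕜) (hΨ : ∀ h, Ψ (δ h) = θ h) (h𝒜 : Ψ 𝒜 = 1) :
    Ψ katz = Ψ C * Ψ col := by
  have := eval_eq_of_cosetTables δ 𝔛 hsep θ hI htab Ψ hΨ
  rwa [map_mul, map_mul, h𝒜, one_mul] at this

/-- … with the universal-norm column discharged by type (`θ ≠ 1`): no hypothesis on `𝒜` beyond its shape. -/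
theorem value_of_cosetTables_universalNorm (δ : I →* A) (𝔛 : Set (A →ₐ[𝕜] 𝕜)) (hsep : Separates 𝔛)
    (θ : I →* 𝕜) (hθ : θ ≠ 1) (hI : (Fintype.card I : 𝕜) ≠ 0) (z katz C col : A)
    (htab : CosetTables δ 𝔛 θ ((1 - inertiaSum δ * z) * katz) (C * col))
    (Ψ : A →ₐ[𝕜] 𝕜) (hΨ : ∀ h, Ψ (δ h) = θ h) :
    Ψ katz = Ψ C * Ψ col :=
  value_of_cosetTables_normalised δ 𝔛 hsep θ hI _ katz C col htab Ψ hΨ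
    (eval_one_sub_inertiaSum_mul δ θ hθ Ψ hΨ z)

omit [Fintype I] in
/-- PROBE (must NOT be provable in general): the coset table does NOT give `X = Y` — only the component.
We record the exact content instead: the full identity needs the tables at EVERY type. -/
theorem eq_of_tables_all_types (δ : I →* A) (𝔛 : Set (A →ₐ[𝕜] 𝕜)) (hsep : Separates 𝔛) (X Y : A)
    (htab : ∀ θ : I →* 𝕜, CosetTables δ 𝔛 θ X Y)
    (htyped : ∀ Φ ∈ 𝔛, ∃ θ : I →* 𝕜, ∀ h, Φ (δ h) = θ h) : X = Y := by
  apply hsep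
  intro Φ hΦ
  obtain ⟨θ, hθ⟩ := htyped Φ hΦ
  exact htab θ Φ hΦ hθ

end Summit.BirchSwinnertonDyer.BirchSwinnertonDyer.Cruxes.SplitBadTwoLowerHalfOfFacts.CriticCosetCutG37
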